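import Mathlib
import Summits.KontsevichZagierPeriods.Zeta5Search.Families.DualExactBridge
import Summits.KontsevichZagierPeriods.Zeta5Search.Families.DualBaseChartsB
import HarnessLib
import HarnessLib.Audit

/-!
# ζ(5) search — Families: D-exact, unconditionally, on the half-space `h₂₇ ≥ 0`

HONEST FRAMING: systematic search; no irrationality claim unless certified.  Cell `pub-zeta5`, certifier 2
(cert-2 g8, 2026-08-22).  Identities between integers attached to Brown–Zudilin's cellular integrals; nothing about
`ζ(5)`, no record of the search is moved by this file.

`Families/DualBaseChartsB` proves the base identity `DualBaseIdentity` (`Φ(0,t) = [t = 0]`), so the conditional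
results of `Families/DualExactTwelve` and `Families/DualExactBridge` hold outright:

* `G_eq_Phi : G e t = Φ e t` — Brown–Zudilin's leading coefficient polynomial family (`Families/DualQPolynomial`) IS the
  extended dual constant term, for all `e : ℕ⁷`, `t : ℤ⁵`;
* `dexact12` — the 12-parameter form `|Qcoeff p q| = CT[…]`;
* **`dexact : bzNum a ≥ 0 → bzDen a ≥ 0 → h₂₇(a) ≥ 0 → |QOf a| = dualConstantTerm a`** — P2's conjecture
  `LeadingCoeffIsDualConstantTerm` (`Families/DualConstantTerm`) on the part `h₂₇(a) = a₃+a₆+2a₇−a₁−a₂−a₅ ≥ 0` (0-based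
  indices) of its cone, which contains Brown–Zudilin's convergent cone and the diagonal.  On the remaining part
  (`h₂₇ < 0`, e.g. `a = (0,1,1,0,2,0,1,0)`) the polynomial family `G` does not apply (a factor `(1+v)^{h₂₇}` with negative
  exponent appears); that part is covered only by the paper proof `HOME/pub-zeta5-p2/g7/DEXACT-PROOF.md`.

Mechanism (see the file headers of the chain): `|Q|` and the dual constant term are the constant terms of the same
Laurent monomial in two volume-preserving charts of the torus of gap ratios of eight points; chart independence of the
constant term is `DualGapFlipStep.ctTrivial_step` iterated along six flips (`DualBaseChartsA/B`).
-/

noncomputable section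

open MvPolynomial Finset

namespace Summit.KontsevichZagierPeriods.Zeta5Search.Families.Cellular

namespace DualR

open Literature.NumberTheory.Irrationality
open Literature.NumberTheory.Irrationality.BrownZudilin2022 (QOf)
open DualQ (eOfA tOfA)

/-- **`G = Φ`**: the polynomial family of `Families/DualQPolynomial` equals the extended dual constant term everywhere. -/
theorem G_eq_Phi (e : Fin 7 → ℕ) (t : Fin 5 → ℤ) : DualQ.G e t = Phi e t :=
  G_eq_Phi_of_base dualBaseIdentity_holds e t

/-- **D-exact in 12 parameters**: `|Qcoeff p q|` is the stated coefficient of the ten-span product. -/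
theorem dexact12 (p : Fin 7 → ℤ) (q : Fin 5 → ℤ) (hp2 : 0 ≤ p 2) (hp4 : 0 ≤ p 4) (hq : ∀ j, 0 ≤ q j)
    (he1 : 0 ≤ q 2 - p 0 - p 6 + p 2 + p 4) (hn : ∀ k, 0 ≤ nExp (DualQ.eOfPQ p q) (DualQ.tOfPQ p q) k)
    (hB : ∀ w, 0 ≤ Bvec (DualQ.eOfPQ p q) (DualQ.tOfPQ p q) w) :
    |BrownZudilin2022.Qcoeff p q| =
      coeff (Finsupp.equivFunOnFinite.symm fun w => (Bvec (DualQ.eOfPQ p q) (DualQ.tOfPQ p q) w).toNat)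
        (tenProd fun k => (nExp (DualQ.eOfPQ p q) (DualQ.tOfPQ p q) k).toNat) :=
  dexact12_of_base dualBaseIdentity_holds p q hp2 hp4 hq he1 hn hB

/-- **D-exact (Brown–Zudilin family).**  On the cone `bzNum a ≥ 0`, `bzDen a ≥ 0`, `h₂₇(a) ≥ 0`, the absolute value
of Brown–Zudilin's leading coefficient `Q(a)` equals the dual constant term of P2 g6
(`Families/DualConstantTerm.dualConstantTerm`). -/
theorem dexact (a : Fin 8 → ℤ) (hA : ∀ i, 0 ≤ bzNum a i) (hB : ∀ i, 0 ≤ bzDen a i)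
    (h27 : 0 ≤ a 3 + a 6 + 2 * a 7 - a 1 - a 2 - a 5) : |QOf a| = dualConstantTerm a :=
  dexact_of_base dualBaseIdentity_holds a hA hB h27

/-- The diagonal instance `a = (n,…,n)`, `n ≥ 0`, of `dexact` (here all side conditions are `n ≥ 0`). -/
theorem dexact_diag (n : ℤ) (hn : 0 ≤ n) : |QOf (fun _ => n)| = dualConstantTerm (fun _ => n) := by
  refine dexact _ (fun i => ?_) (fun i => ?_) (by omega)
  · fin_cases i <;> simp [bzNum] <;> omega
  · fin_cases i <;> simp [bzDen, BrownZudilin2022.b24, BrownZudilin2022.b14, BrownZudilin2022.b57, BrownZudilin2022.b35,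
      BrownZudilin2022.b36] <;> omega

end DualR

end Summit.KontsevichZagierPeriods.Zeta5Search.Families.Cellular
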